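import Literature.AlgebraicGeometry.Resolution.NashBlowupToricLoop
import HarnessLib

/-!
# Crux `NoZenoR` / `NoZeno` (stmt-ResolutionOfSingularities-19943 / -16483), kill test K4.4g «KC-Nash»:
# the EIGEN-CERTIFICATE of the CDLAL toric Nash blow-up loop (the unique loop direction `w`, ratio `μ`)

Route `ResolutionOfSingularities/HomologicalConductor`.  OURS (cell res-hironaka, chain W4.4, object U1 of planner
res-L0-w44-plan-1's UNCLAIMED-STUB LIST v2, CUT (ρ4) 2026-08-27T09:44:14Z «§E eigen-certificate»; consulting memo
res-L0-w44-tri-2 `KC-NASH.md` v1.1 §2, whose exact data this file re-derives in the kernel); nothing here is a statement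
of the manuscript under review [Hironaka2017], nothing asserts a Theses declaration, and nothing here is in the source
[CastilloEtAl2024] — which is why it lives in `Summits/…/Theorems/` and not in `Literature/` (the cited combinatorics of
the loop itself are `Literature.AlgebraicGeometry.Resolution.CDLAL.*`, files `NashBlowupToricLoop.lean` and
`NashBlowupToricLoopNormalized.lean`).

Content (all kernel theorems):
* `CDLAL.card_nondegenerate` — exactly `28` of the `35` four-element subsets of the Hilbert basis `𝓗(S)` are
  non-degenerate (KC-NASH §1 «28 of the 35 four-element subsets of H have det ≠ 0, all values in {±1, ±2, ±3}»).
* `CDLAL.U_pow_four` — `U⁴ − U² − 2U + 1 = 0` (KC-NASH §2: `charpoly(U) = x⁴ − x² − 2x + 1`).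
* `CDLAL.exists_root_mu` — a real root `μ ∈ (0.4257866663, 0.4257866664)` of `x⁴ − x² − 2x + 1` (KC-NASH §2:
  `μ = 0.42578666631…`).
* `CDLAL.eigenweight` — for every root `μ`, the weight `w = (μ, (2 + μ² − μ³)/3, μ + μ², 1)` satisfies
  `⟨U v, w⟩ = μ ⟨v, w⟩` for all `v ∈ ℤ⁴` (`Uᵀ w = μ w`): the monomial valuation `v_w` is carried by the loop `U` to `μ`
  times itself — the «StrictDrop ratio `γ_{m+1}/γ_m = μ` on the loop datum» of KC-NASH §2 / §3.3, and the
  self-similar-seed shape of `Theorems/StrictDrop/Negative/StrictDropFalseOfSelfSimilarSeed.lean`.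
* `CDLAL.eigenweight_pos` — for `μ` in that interval, `⟨hᵢ, w⟩ > 0` for all seven Hilbert-basis vectors: `w` is an
  INTERIOR weight of `σ = ω^∨` (hence of `τ = U^{−T}σ`, by `eigenweight`): KC-NASH §2 «CERTIFICATE `w ∈ int τ`».
NOT here: simplicity of the dominant eigenvalue `1/μ` (uniqueness of the loop direction), the cohomology-annihilator
datum `H_KC` (KC-NASH §3 — OPEN), any `¬ NoZenoR` claim.  AI-formalised, weaker than expert review.
-/

noncomputable section

-- single-problem summit: the doubled namespace component is forced
set_option linter.dupNamespace false

namespace Summit.ResolutionOfSingularities.ResolutionOfSingularities.Theorems.NoZeno.NashLoop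

open Matrix Literature.AlgebraicGeometry.Resolution.CDLAL

/-- [OURS · L0 W4.4 · K4.4g] Exactly `28` of the `35` four-element subsets of `𝓗(S) = {h₁,…,h₇}` are non-degenerate
(subsets counted as increasing quadruples `a < b < c < d`, the minor written out as in part II's `CDLAL.det4`;
KC-NASH v1.1 §1). [folklore] -/
theorem card_nondegenerate :
    (∑ a : Fin 7, ∑ b : Fin 7, ∑ c : Fin 7, ∑ d : Fin 7, if a < b ∧ b < c ∧ c < d then 1 else 0) = 35 ∧
    (∑ a : Fin 7, ∑ b : Fin 7, ∑ c : Fin 7, ∑ d : Fin 7,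
      if a < b ∧ b < c ∧ c < d ∧ (colMatrix ![h a, h b, h c, h d]).det ≠ 0 then 1 else 0) = 28 := by
  constructor <;> decide

/-- [OURS · L0 W4.4 · K4.4g] `U⁴ − U² − 2U + 1 = 0` for CDLAL's loop matrix `U` (its characteristic polynomial is
`x⁴ − x² − 2x + 1`; KC-NASH v1.1 §2). [folklore] -/
theorem U_pow_four : U ^ 4 - U ^ 2 - 2 • U + 1 = 0 := by decide

/-- [OURS · L0 W4.4 · K4.4g] There is a real root `μ` of `x⁴ − x² − 2x + 1` with `0.4257866663 < μ < 0.4257866664`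
(KC-NASH v1.1 §2: `μ = 0.42578666631…`; intermediate value theorem on the sign change). [folklore] -/
theorem exists_root_mu :
    ∃ μ : ℝ, (0.4257866663 : ℝ) < μ ∧ μ < 0.4257866664 ∧ μ ^ 4 - μ ^ 2 - 2 * μ + 1 = 0 := by
  let f : ℝ → ℝ := fun x => x ^ 4 - x ^ 2 - 2 * x + 1
  have hf : Continuous f := by fun_prop
  have hab : (0.4257866663 : ℝ) ≤ 0.4257866664 := by norm_num
  have h0 : (0 : ℝ) ∈ Set.Icc (f 0.4257866664) (f 0.4257866663) := by
    constructor <;> norm_num [f]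
  obtain ⟨μ, ⟨hμa, hμb⟩, hμ⟩ := intermediate_value_Icc' hab hf.continuousOn h0
  refine ⟨μ, lt_of_le_of_ne hμa ?_, lt_of_le_of_ne hμb ?_, hμ⟩
  · rintro rfl; norm_num [f] at hμ
  · rintro rfl; norm_num [f] at hμ

/-- [OURS · L0 W4.4 · K4.4g] **The loop direction.**  For a root `μ` of `x⁴ − x² − 2x + 1`, the weight
`w = (μ, (2 + μ² − μ³)/3, μ + μ², 1)` is an eigenvector of `Uᵀ` for `μ`: `⟨U v, w⟩ = μ ⟨v, w⟩` for every `v ∈ ℤ⁴` — the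
monomial valuation with weight `w` is carried to `μ` times itself by the loop (KC-NASH v1.1 §2 «`Uᵀw = μ·w`»; the
StrictDrop ratio on the loop datum is exactly `μ`). [folklore] -/
theorem eigenweight (μ : ℝ) (hμ : μ ^ 4 - μ ^ 2 - 2 * μ + 1 = 0) (v : Fin 4 → ℤ) :
    let w : Fin 4 → ℝ := ![μ, (2 + μ ^ 2 - μ ^ 3) / 3, μ + μ ^ 2, 1]
    (∑ i, ((U *ᵥ v) i : ℝ) * w i) = μ * ∑ i, (v i : ℝ) * w i := by
  intro w
  simp only [U, mulVec, dotProduct, Fin.sum_univ_four, w, cons_val_zero, cons_val_one, of_apply, cons_val',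
    empty_val', cons_val_fin_one, Fin.isValue]
  push_cast
  linear_combination ((1 : ℝ) / 3 * (v 1 : ℝ)) * hμ

/-- [OURS · L0 W4.4 · K4.4g] **`w` is an interior weight:** for `0.4257866663 < μ < 0.4257866664`, `⟨hᵢ, w⟩ > 0` for
all seven Hilbert-basis vectors `hᵢ` of `S` (hence, by `eigenweight`, also `⟨U hᵢ, w⟩ = μ ⟨hᵢ, w⟩ > 0`:
`w ∈ int σ ∩ int τ`; KC-NASH v1.1 §2 «CERTIFICATE `w ∈ int τ`»). [folklore] -/
theorem eigenweight_pos (μ : ℝ) (h1 : (0.4257866663 : ℝ) < μ) (h2 : μ < 0.4257866664) (g : Fin 7) :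
    let w : Fin 4 → ℝ := ![μ, (2 + μ ^ 2 - μ ^ 3) / 3, μ + μ ^ 2, 1]
    0 < ∑ i, (h g i : ℝ) * w i := by
  intro w
  have hμ0 : (0 : ℝ) < μ := by linarith
  have hμ1 : μ < 1 := by linarith
  fin_cases g <;>
    simp only [h, Fin.sum_univ_four, w, cons_val_zero, cons_val_one, cons_val', empty_val', cons_val_fin_one,
      Fin.isValue, Fin.reduceFinMk, Fin.mk_one, Fin.zero_eta] <;>
    push_cast <;> nlinarith [mul_pos hμ0 hμ0, mul_pos (mul_pos hμ0 hμ0) hμ0]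

end Summit.ResolutionOfSingularities.ResolutionOfSingularities.Theorems.NoZeno.NashLoop

end
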